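import Mathlib
import Summits.KontsevichZagierPeriods.KontsevichZagierPeriods.Theorems.InverseLandauTateLiftingProdSplit
import Literature.NumberTheory.Transcendental.KZLogCalculusProofs
import Literature.NumberTheory.Transcendental.SemialgebraicMapsProofs

/-!
# `TateLifting` (stmt-KontsevichZagierPeriods-9129), line `Sketch` — stub 45: ROTATION SPLITTING

The rotation engine of the line (stub 44) turns a representation `r = [σ, f]` of dimension `n + 2`,
invariant under the rotations of its last two coordinates, into the REDUCED representation

  `q = [D, 2ρ/(1+u²) · f(v, ρ, 0)]`,  `D = {w = (v, ρ, u) | ρ > 0, (v, ρ, 0) ∈ σ} = M × ℝ`,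

with `M = {p = (v, ρ) ∈ ℝⁿ⁺¹ | ρ > 0, (p, 0) ∈ σ}` (coordinates: `(v, ρ) = Fin.init w`, `u = w last`,
the axis point `(v, ρ, 0) = Fin.snoc (Fin.init w) 0`). This file proves `tateLifting_rotationSplit`:
the honest MERIDIAN representation `m = [M, 2ρ · f(p, 0)]` and the arctangent representation
`c = [ℝ, 1/(1+u²)]` EXIST, and `[q] − [m]·[c] ∈ KZ.relations`.

* `c` is honest: `1/(1+u²)` is a quotient of `ℚ`-polynomials with non-vanishing denominator and is
  absolutely integrable on `ℝ` (Mathlib's `integrable_inv_one_add_sq`, transported to `Fin 1 → ℝ`).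
* `m` is honest: `M` is the intersection of `{ρ > 0}` with the preimage of `σ` under the polynomial map
  `p ↦ (p, 0)` (`IsSemialgebraic.preimage_aeval`, no Tarski–Seidenberg); the integrand is the product of
  the polynomial `2ρ` with the composition of `f` with that polynomial map (Tarski–Seidenberg,
  `IsSemialgebraicFunOn.comp_isSemialgebraicMapOn_holds`); and its absolute integrability on `M` is
  FUBINI applied to the reduced representation: after the volume-preserving identification
  `ℝⁿ⁺² ≃ ℝ × ℝⁿ⁺¹`, `(u, p) ↦ Fin.snoc p u` (`MeasurableEquiv.piFinSuccAbove`), the integrand of `q`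
  extended by zero is `(u, p) ↦ h(u) · g(p)` with `h = 1/(1+u²)` nowhere zero and `g` the meridian
  integrand extended by zero off `M`; almost every `u`-section `p ↦ h(u) · g(p)` of an integrable
  function is integrable (`MeasureTheory.Integrable.prod_right_ae`), and dividing one of them by
  `h(u) ≠ 0` gives the integrability of `g`.
* the relation is the landed PRODUCT SPLITTING `tateLifting_prodSplit` in dimensions `(n + 1) + 1`:
  `D` is literally the product domain `M × ℝ` and the integrand of `q` is `(2ρ · f(p, 0)) ⊗ (1/(1+u²))`
  on it.

References: M. Kontsevich, D. Zagier, *Periods* (2001), §1.1 eq. (1) (`π = ∫ dx/(1+x²)`), §4.1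
("the product of integrals is again an integral (Fubini)"); J. Bochnak, M. Coste, M.-F. Roy,
*Real Algebraic Geometry* (1998), §2.2.
-/

noncomputable section

open MeasureTheory Set
open Literature.NumberTheory.Transcendental
open Literature.ModelTheory.ExponentialFields (IsSemialgebraic)

namespace Summit.KontsevichZagierPeriods.InverseLandau

namespace RotationSplit

variable {n : ℕ}

/-! ## The arctangent representation `[ℝ, du/(1+u²)]` -/

/-- The honest representation `c = [ℝ, 1/(1+u²)]` of dimension `1` exists: its integrand is a quotient of
`ℚ`-polynomials with non-vanishing denominator, absolutely integrable on `ℝ`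
(`integrable_inv_one_add_sq` transported along `MeasurableEquiv.funUnique`).
[cite: KontsevichZagier2001, §1.1 eq. (1)] -/
theorem exists_arctanRep_univ : ∃ c : KZ.IntegralRep 1, c.domain = Set.univ ∧
    (c.integrand = fun u => 1 / (1 + u 0 ^ 2)) := by
  have hsa : IsSemialgebraicFunOn ℚ (Set.univ : Set (Fin 1 → ℝ))
      (fun u : Fin 1 → ℝ => 1 / (1 + u 0 ^ 2)) := by
    refine (isSemialgebraicFunOn_aeval_div_aeval
      Literature.ModelTheory.ExponentialFields.isSemialgebraic_univ
      (1 : MvPolynomial (Fin 1) ℚ) (1 + MvPolynomial.X 0 ^ 2) fun x _ => ?_).congr fun x _ => ?_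
    · simp only [map_add, map_one, map_pow, MvPolynomial.aeval_X]; positivity
    · simp
  have hint : IntegrableOn (fun u : Fin 1 → ℝ => 1 / (1 + u 0 ^ 2)) Set.univ := by
    rw [integrableOn_univ]
    have h := (volume_preserving_funUnique (Fin 1) ℝ).integrable_comp_of_integrable
      integrable_inv_one_add_sq
    refine h.congr (Filter.Eventually.of_forall fun u => ?_)
    simp [MeasurableEquiv.funUnique, one_div]
  exact ⟨⟨Set.univ, _, Literature.ModelTheory.ExponentialFields.isSemialgebraic_univ, hsa, hint⟩,
    rfl, rfl⟩

/-! ## The meridian `[M, 2ρ · f(p, 0)]`: semialgebraicity -/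

/-- The axis embedding `p ↦ (p, 0) = Fin.snoc p 0 : ℝⁿ⁺¹ → ℝⁿ⁺²` is the polynomial map with coordinates
`(X₀, …, X_n, 0)`. [folklore] -/
theorem aeval_snocPoly (p : Fin (n + 1) → ℝ) :
    (fun j => MvPolynomial.aeval p
      ((Fin.snoc (fun i => MvPolynomial.X i) 0 : Fin (n + 2) → MvPolynomial (Fin (n + 1)) ℚ) j)) =
      (Fin.snoc p 0 : Fin (n + 2) → ℝ) := by
  ext j
  refine Fin.lastCases ?_ (fun i => ?_) j
  · simp
  · simp

/-- The meridian domain `M = {p ∈ ℝⁿ⁺¹ | p last > 0, (p, 0) ∈ σ}` of a `ℚ`-semialgebraic `σ ⊆ ℝⁿ⁺²` is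
`ℚ`-semialgebraic: a positivity set intersected with the preimage of `σ` under the polynomial map
`p ↦ (p, 0)` (`IsSemialgebraic.preimage_aeval`). [cite: BCR1998, §2.1] -/
theorem isSemialgebraic_meridianDomain {σ : Set (Fin (n + 2) → ℝ)} (hσ : IsSemialgebraic ℚ σ) :
    IsSemialgebraic ℚ {p : Fin (n + 1) → ℝ | 0 < p (Fin.last n) ∧
      (Fin.snoc p 0 : Fin (n + 2) → ℝ) ∈ σ} := by
  have h1 : IsSemialgebraic ℚ {p : Fin (n + 1) → ℝ | 0 < p (Fin.last n)} := by
    simpa using Literature.ModelTheory.ExponentialFields.isSemialgebraic_setOf_eval_pos (k := ℚ)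
      (R := ℝ) (MvPolynomial.X (Fin.last n) : MvPolynomial (Fin (n + 1)) ℚ)
  have h2 : IsSemialgebraic ℚ {p : Fin (n + 1) → ℝ | (Fin.snoc p 0 : Fin (n + 2) → ℝ) ∈ σ} := by
    convert hσ.preimage_aeval
      (Fin.snoc (fun i => MvPolynomial.X i) 0 : Fin (n + 2) → MvPolynomial (Fin (n + 1)) ℚ) using 1
    ext p
    simp only [mem_setOf_eq, mem_preimage, aeval_snocPoly]
  exact h1.inter h2

/-- The axis embedding `p ↦ (p, 0)` is a `ℚ`-semialgebraic map on every `ℚ`-semialgebraic set (it is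
polynomial). [cite: BCR1998, §2.2] -/
theorem isSemialgebraicMapOn_snocZero {s : Set (Fin (n + 1) → ℝ)} (hs : IsSemialgebraic ℚ s) :
    IsSemialgebraicMapOn ℚ s (fun p => (Fin.snoc p 0 : Fin (n + 2) → ℝ)) := by
  convert isSemialgebraicMapOn_aeval hs
    (Fin.snoc (fun i => MvPolynomial.X i) 0 : Fin (n + 2) → MvPolynomial (Fin (n + 1)) ℚ) using 2
    with p
  exact (aeval_snocPoly p).symm

/-- The meridian integrand `p ↦ 2 · p last · f (p, 0)` is `ℚ`-semialgebraic on the meridian domain `M`: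
the product of the polynomial `2 X_last` with the composition of `f` (semialgebraic on `σ ⊇ (M, 0)`) with
the polynomial axis embedding (Tarski–Seidenberg). [cite: BochnakCosteRoy1998, Prop. 2.2.6] -/
theorem isSemialgebraicFunOn_meridian {σ : Set (Fin (n + 2) → ℝ)} {f : (Fin (n + 2) → ℝ) → ℝ}
    (hσ : IsSemialgebraic ℚ σ) (hf : IsSemialgebraicFunOn ℚ σ f) :
    IsSemialgebraicFunOn ℚ {p : Fin (n + 1) → ℝ | 0 < p (Fin.last n) ∧
        (Fin.snoc p 0 : Fin (n + 2) → ℝ) ∈ σ}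
      (fun p => 2 * p (Fin.last n) * f (Fin.snoc p 0 : Fin (n + 2) → ℝ)) := by
  have hM := isSemialgebraic_meridianDomain hσ
  have hJ : IsSemialgebraicFunOn ℚ {p : Fin (n + 1) → ℝ | 0 < p (Fin.last n) ∧
      (Fin.snoc p 0 : Fin (n + 2) → ℝ) ∈ σ} (fun p => 2 * p (Fin.last n)) := by
    refine (isSemialgebraicFunOn_aeval hM
      (MvPolynomial.C 2 * MvPolynomial.X (Fin.last n) : MvPolynomial (Fin (n + 1)) ℚ)).congr
      fun p _ => ?_
    simp
  exact (IsSemialgebraicFunOn.mul_holds hJ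
    (IsSemialgebraicFunOn.comp_isSemialgebraicMapOn_holds hf (isSemialgebraicMapOn_snocZero hM)
      fun p hp => hp.2)).congr fun _ _ => rfl

/-! ## The meridian: absolute integrability by Fubini -/

/-- **One good section.** If `w ↦ h (w last) · G (init w)` is integrable on `ℝᴺ⁺¹` and `h` vanishes
nowhere, then `G` is integrable on `ℝᴺ`: after the volume-preserving identification `ℝᴺ⁺¹ ≃ ℝ × ℝᴺ`,
`(t, p) ↦ Fin.snoc p t` (`MeasurableEquiv.piFinSuccAbove`), almost every section `p ↦ h t · G p` is
integrable (`MeasureTheory.Integrable.prod_right_ae`); divide one of them by `h t ≠ 0`. [folklore] -/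
theorem integrable_of_integrable_mul_init {N : ℕ} {G : (Fin N → ℝ) → ℝ} {h : ℝ → ℝ}
    (hh : ∀ t, h t ≠ 0)
    (hint : Integrable (fun w : Fin (N + 1) → ℝ => h (w (Fin.last N)) * G (Fin.init w))) :
    Integrable G := by
  set e : (Fin (N + 1) → ℝ) ≃ᵐ ℝ × (Fin N → ℝ) :=
    MeasurableEquiv.piFinSuccAbove (fun _ => ℝ) (Fin.last N) with he_def
  have he : MeasurePreserving e volume volume :=
    volume_preserving_piFinSuccAbove (fun _ => ℝ) (Fin.last N)
  have he_symm : ∀ q : ℝ × (Fin N → ℝ), e.symm q = Fin.snoc q.2 q.1 := fun q => by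
    rw [he_def, MeasurableEquiv.piFinSuccAbove_symm_apply, Fin.insertNthEquiv_last]
    rfl
  have h2 : Integrable (fun q : ℝ × (Fin N → ℝ) => h q.1 * G q.2)
      ((volume : Measure ℝ).prod (volume : Measure (Fin N → ℝ))) := by
    have h' := ((he.symm e).integrable_comp_emb e.symm.measurableEmbedding
      (g := fun w : Fin (N + 1) → ℝ => h (w (Fin.last N)) * G (Fin.init w))).mpr hint
    rw [← Measure.volume_eq_prod]
    convert h' using 1
    ext q
    simp [he_symm]
  obtain ⟨t, ht⟩ := h2.prod_right_ae.exists
  refine (ht.const_mul (h t)⁻¹).congr (ae_of_all _ fun p => ?_)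
  show (h t)⁻¹ * (h t * G p) = G p
  rw [inv_mul_cancel_left₀ (hh t)]

/-- **Integrability of the meridian integrand** (Fubini applied to the reduced representation): if
`w ↦ 2ρ/(1+u²) · f(v, ρ, 0)` is absolutely integrable on `D = {w | init w ∈ M}`, then `p ↦ 2 · p last · f(p, 0)`
is absolutely integrable on `M` — the integrand of the reduced representation extended by zero is
`(1/(1+u²)) · g(init w)` with `g` the meridian integrand extended by zero off `M`, and `1/(1+u²) ≠ 0`.
[cite: KontsevichZagier2001, §4.1] -/
theorem integrableOn_meridian {σ : Set (Fin (n + 2) → ℝ)} {f : (Fin (n + 2) → ℝ) → ℝ}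
    {D : Set (Fin (n + 2) → ℝ)} (hDm : MeasurableSet D)
    (hD : D = {w | 0 < (Fin.init w : Fin (n + 1) → ℝ) (Fin.last n) ∧
      (Fin.snoc (Fin.init w : Fin (n + 1) → ℝ) 0 : Fin (n + 2) → ℝ) ∈ σ})
    (hM : MeasurableSet {p : Fin (n + 1) → ℝ | 0 < p (Fin.last n) ∧
      (Fin.snoc p 0 : Fin (n + 2) → ℝ) ∈ σ})
    (hint : IntegrableOn (fun w => 2 * (Fin.init w : Fin (n + 1) → ℝ) (Fin.last n) /
          (1 + w (Fin.last (n + 1)) ^ 2) *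
        f (Fin.snoc (Fin.init w : Fin (n + 1) → ℝ) 0 : Fin (n + 2) → ℝ)) D) :
    IntegrableOn (fun p => 2 * p (Fin.last n) * f (Fin.snoc p 0 : Fin (n + 2) → ℝ))
      {p : Fin (n + 1) → ℝ | 0 < p (Fin.last n) ∧ (Fin.snoc p 0 : Fin (n + 2) → ℝ) ∈ σ} := by
  rw [← integrable_indicator_iff hM]
  rw [← integrable_indicator_iff hDm] at hint
  refine integrable_of_integrable_mul_init (h := fun u => 1 / (1 + u ^ 2)) (fun u => by positivity)
    (hint.congr (ae_of_all _ fun w => ?_))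
  beta_reduce
  by_cases hw : (Fin.init w : Fin (n + 1) → ℝ) ∈ {p : Fin (n + 1) → ℝ | 0 < p (Fin.last n) ∧
      (Fin.snoc p 0 : Fin (n + 2) → ℝ) ∈ σ}
  · have hwD : w ∈ D := by rw [hD]; exact hw
    rw [indicator_of_mem hwD, indicator_of_mem hw]
    ring
  · have hwD : w ∉ D := by rw [hD]; exact hw
    rw [indicator_of_notMem hwD, indicator_of_notMem hw, mul_zero]

end RotationSplit

/-- **Rotation splitting** (stub `stub_rotationSplit` of the lead's skeleton, the body of
`RotationSplit`). Let `q` be the reduced representation of the rotation engine over `r = [σ, f]`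
(dimension `n + 2`): domain `D = {w = (v, ρ, u) | ρ > 0, (v, ρ, 0) ∈ σ}`, integrand
`2ρ/(1+u²) · f(v, ρ, 0)`. Then the honest MERIDIAN `m = [M, 2ρ · f(p, 0)]`,
`M = {p ∈ ℝⁿ⁺¹ | p last > 0, (p, 0) ∈ σ}` (semialgebraic by a polynomial preimage; integrand semialgebraic
by Tarski–Seidenberg; absolutely integrable by Fubini applied to `q`, `1/(1+u²) ≠ 0`), and the honest
`c = [ℝ, 1/(1+u²)]` exist, and `[q] − [m]·[c] ∈ KZ.relations` by the product splitting
`tateLifting_prodSplit` (`D = M × ℝ`, integrand `(2ρ · f(p, 0)) ⊗ (1/(1+u²))`).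
[cite: KontsevichZagier2001, §4.1] -/
theorem tateLifting_rotationSplit :
  ∀ (n : ℕ) (r q : KZ.IntegralRep (n + 2)),
    q.domain = {w | 0 < (Fin.init w : Fin (n + 1) → ℝ) (Fin.last n) ∧
        (Fin.snoc (Fin.init w : Fin (n + 1) → ℝ) 0 : Fin (n + 2) → ℝ) ∈ r.domain} →
    (q.integrand = fun w => 2 * (Fin.init w : Fin (n + 1) → ℝ) (Fin.last n) /
          (1 + w (Fin.last (n + 1)) ^ 2) *
        r.integrand (Fin.snoc (Fin.init w : Fin (n + 1) → ℝ) 0 : Fin (n + 2) → ℝ)) →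
    ∃ (m : KZ.IntegralRep (n + 1)) (c : KZ.IntegralRep 1),
      m.domain = {p | 0 < p (Fin.last n) ∧ (Fin.snoc p 0 : Fin (n + 2) → ℝ) ∈ r.domain} ∧
      (m.integrand = fun p => 2 * p (Fin.last n) * r.integrand (Fin.snoc p 0 : Fin (n + 2) → ℝ)) ∧
      c.domain = Set.univ ∧ (c.integrand = fun u => 1 / (1 + u 0 ^ 2)) ∧
      KZ.of q - KZ.of m * KZ.of c ∈ KZ.relations := by
  intro n r q hqd hqi
  have hM : IsSemialgebraic ℚ {p : Fin (n + 1) → ℝ | 0 < p (Fin.last n) ∧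
      (Fin.snoc p 0 : Fin (n + 2) → ℝ) ∈ r.domain} :=
    RotationSplit.isSemialgebraic_meridianDomain r.isSemialgebraic_domain
  have hg := RotationSplit.isSemialgebraicFunOn_meridian r.isSemialgebraic_domain
    r.isSemialgebraicFunOn_integrand
  have hgint : IntegrableOn (fun p => 2 * p (Fin.last n) * r.integrand (Fin.snoc p 0 : Fin (n + 2) → ℝ))
      {p : Fin (n + 1) → ℝ | 0 < p (Fin.last n) ∧ (Fin.snoc p 0 : Fin (n + 2) → ℝ) ∈ r.domain} := by
    have hq := q.integrableOn
    rw [hqi] at hq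
    exact RotationSplit.integrableOn_meridian (KZ.IntegralRep.measurableSet_domain_holds q) hqd
      (IsSemialgebraic.measurableSet_holds hM) hq
  obtain ⟨c, hcd, hci⟩ := RotationSplit.exists_arctanRep_univ
  refine ⟨⟨_, _, hM, hg, hgint⟩, c, rfl, rfl, hcd, hci, ?_⟩
  refine tateLifting_prodSplit (n + 1) 1 q _ c ?_ fun w hw => ?_
  · rw [hqd, hcd]
    ext w
    simp only [mem_setOf_eq, mem_univ, and_true]
    exact Iff.rfl
  · rw [hqi, hci]
    have hlast : w (Fin.natAdd (n + 1) 0) = w (Fin.last (n + 1)) := congrArg w (Fin.ext (by simp))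
    show 2 * (Fin.init w : Fin (n + 1) → ℝ) (Fin.last n) / (1 + w (Fin.last (n + 1)) ^ 2) *
        r.integrand (Fin.snoc (Fin.init w : Fin (n + 1) → ℝ) 0 : Fin (n + 2) → ℝ) =
      2 * (Fin.init w : Fin (n + 1) → ℝ) (Fin.last n) *
        r.integrand (Fin.snoc (Fin.init w : Fin (n + 1) → ℝ) 0 : Fin (n + 2) → ℝ) *
        (1 / (1 + w (Fin.natAdd (n + 1) 0) ^ 2))
    rw [hlast]
    ring

end Summit.KontsevichZagierPeriods.InverseLandau

end
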